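import Literature.NumberTheory.Rogawski1990.ArchCentralLimitCornerValueFromBall   -- ★ p844274 (this seat): (o4) `cornerValue_min_of_ball` and its `hBall` binder
import Mathlib.Analysis.Calculus.BumpFunction.FiniteDimension
import HarnessLib

/-!
# N1 ASSEMBLY, FILE (o4′) — THE EXPORT ADAPTER «hBall ⟸ hCore»: what W6 proves, in the chart tokens of ★ `exists_wallGerm_psi` (F0P3a-p05) and ★ `exists_wallGerm_chi` (A-p14),
# with AMBIENT compact support — packaged into (o4)'s `hBall` (Rogawski 1990 §8.4 pp. 126–127; Helgason, Groups and Geometric Analysis, Ch. I §1 No. 2 — `K`-invariant cut-offs)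

Topic `NumberTheory/Rogawski1990`; namespace `Literature.NumberTheory.Rogawski1990`.  THEOREMS ONLY (no `def`, no instance, no notation, no axiom, no named fact, no `sorry`).
Cell `pub/hodgecm-mathlib`, ENGINE T1 (crux H413 = `stmt-HodgeConjecture-24833`); ROAD A toward N1 = `stub_L21` ∕ `stub_ArchCentralLimitU21`; ROAD A owner F0P3a-p05 (g14) WORD R-14.4 (2)
(«(o4) is p02's»); bus 2026-09-01T13:0xZ «(o4′) hBall ⟸ hCore».  HONEST LABEL: HC_CM is proved only modulo the printed citations until rung 0 closes; bookkeeping around the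
printed-hard letter N1 (★ p842205 `ArchCentralLimitFormulaRankTwo`), pays nothing by itself.

WHY.  ★ (o4) `cornerValue_min_of_ball` consumes `hBall`: for every Haar `μ` on `U(2,1)` one `c(μ) > 0` such that every smooth `Θ′` with compact support ON THE GROUP
(`HasCompactSupport (fun u : U21 => Θ′ (mat u))`) and `K`-conjugation-invariant admits (A4)-I wall germs `ψ, χ` + the value, the torus written as
`mkU21 (diagonal fun i => ↑(Z i)) (diagonal_circle_preserves Z)`.  The chart engine's ★ germs (`exists_wallGerm_psi`, `exists_wallGerm_chi`) want AMBIENT `HasCompactSupport Θ`,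
write the wall point as `mkU21 (diagonal ![↑(ζe^{it}), ↑(ζe^{it}), ↑(ζe^{−2it})]) (diagonal_uuv_preserves …)`, the normal ray as the ambient product
`mat u * diagonal (…·exp(y·(δ_{k0} − δ_{k1}))) * mat u⁻¹`, the scalings as `(2 − 2cos 3t) • _` and `‖ζe^{−2it} − ζe^{it}‖⁴ • _`, and the centre as `Θ ((ζ:ℂ) • 1)`.  THIS FILE
bridges all four: **`ballWallValue_of_core (hcore) : hBall`** and the composite **`cornerValue_min_of_core`** = ★ `cornerValue_min_of_ball ∘ ballWallValue_of_core`, so that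
W6's deliverable is exactly `hcore` (module docstring of §3) — the two ★ germ identities feed its `ψ`∕`χ` clauses verbatim and only the VALUE line is new mathematics.

HOW.  §1 token bridges (`Subtype.ext`∕`Units.ext` on `mkU21`, `fin_cases`), the scalar identity `‖ζe^{−2it} − ζe^{it}‖⁴ = (2 − 2cos 3t)²`, the centre `ζ•1 = ↑(circleDiagonal 3 ζ) =
mat (mkU21 (ζ•1) _)`.  §2 the `K`-INVARIANT AMBIENT CUT-OFF: for `Θ′` smooth, `K`-invariant, with compact support on `U(2,1)`, the `K`-average `ρ = (f)^K` (★ `contDiff_kAverage`,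
★ `kAverage_conj_of_unitary_comm_J`) of a `ContDiffBump f` at `0` that is `1` on the compact set `Ad(K)·mat(tsupport)` is smooth, `K`-invariant, compactly supported in `M₃(ℂ)` and
`≡ m_K` on `mat(tsupport)`; `Θ̃ := (m_K⁻¹ρ)•Θ′` is smooth, `K`-invariant, AMBIENTLY compactly supported and `Θ̃ ∘ mat = Θ′ ∘ mat` (`exists_kInvariant_ambient_cutoff`).  §3 packaging.
-/

open Filter Topology Set MeasureTheory Measure NumberField NumberField.InfinitePlace Matrix MulAction Metric
open Literature.NumberTheory.Automorphic Literature.NumberTheory.Automorphic.UnitaryGroup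
open Literature.Geometry.ComplexHyperbolic Literature.Geometry.ComplexHyperbolic.BallModel
open scoped Matrix MatrixGroups Matrix.Norms.Operator ContDiff

namespace Literature.NumberTheory.Rogawski1990

noncomputable section

/-! ## §1. Token bridges -/

/-- The `θ₂`-minimal wall point: (o4)'s torus token equals the chart engine's `mkU21 (diagonal ![ζe^{it}, ζe^{it}, ζe^{−2it}]) _`. [cite: Rogawski1990, §8.4 pp. 126–127] -/
theorem mkU21_wallPoint_eq (ζ : Circle) (t : ℝ) :
    BallModel.mkU21 (Matrix.diagonal fun i => (((fun j : Fin 3 => ζ * Circle.exp ((t • (![1, 1, -2] : Fin 3 → ℝ)) j)) i : Circle) : ℂ)) (BallModel.diagonal_circle_preserves (fun j : Fin 3 => ζ * Circle.exp ((t • (![1, 1, -2] : Fin 3 → ℝ)) j))) =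
      BallModel.mkU21 (Matrix.diagonal ![((ζ * Circle.exp t : Circle) : ℂ), ((ζ * Circle.exp t : Circle) : ℂ), ((ζ * Circle.exp (-2 * t) : Circle) : ℂ)]) (BallModel.diagonal_uuv_preserves (ζ * Circle.exp t) (ζ * Circle.exp (-2 * t))) := by
  apply Subtype.ext
  apply Units.ext
  show Matrix.diagonal _ = Matrix.diagonal _
  congr 1
  funext i
  fin_cases i <;> simp
  ring_nf

/-- The normal ray through the wall point: the chart engine's ambient product `mat u · diag(…·e^{iy(δ_{k0}−δ_{k1})}) · mat u⁻¹` equals (o4)'s `mat (u · mkU21 (diag Zs) _ · u⁻¹)`.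
[cite: Rogawski1990, §8.4 pp. 126–127] -/
theorem mat_mul_normalRayDiagonal_mul_mat_inv_eq (ζ : Circle) (t s : ℝ) (u : BallModel.U21) :
    BallModel.mat u * Matrix.diagonal (fun k : Fin 3 => (((![ζ * Circle.exp t, ζ * Circle.exp t, ζ * Circle.exp (-2 * t)] : Fin 3 → Circle) k * Circle.exp (s * ((if k = (0 : Fin 3) then (1 : ℝ) else 0) - (if k = (1 : Fin 3) then (1 : ℝ) else 0))) : Circle) : ℂ)) * BallModel.mat u⁻¹ =
      BallModel.mat (u * BallModel.mkU21 (Matrix.diagonal fun i => (((fun j : Fin 3 => (fun i : Fin 3 => ζ * Circle.exp ((t • (![1, 1, -2] : Fin 3 → ℝ)) i)) j * Circle.exp (s * (![1, -1, 0] : Fin 3 → ℝ) j)) i : Circle) : ℂ)) (BallModel.diagonal_circle_preserves (fun j : Fin 3 => (fun i : Fin 3 => ζ * Circle.exp ((t • (![1, 1, -2] : Fin 3 → ℝ)) i)) j * Circle.exp (s * (![1, -1, 0] : Fin 3 → ℝ) j))) * u⁻¹) := by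
  have hFG : (fun k : Fin 3 => (((![ζ * Circle.exp t, ζ * Circle.exp t, ζ * Circle.exp (-2 * t)] : Fin 3 → Circle) k * Circle.exp (s * ((if k = (0 : Fin 3) then (1 : ℝ) else 0) - (if k = (1 : Fin 3) then (1 : ℝ) else 0))) : Circle) : ℂ)) =
      (fun i : Fin 3 => (((fun j : Fin 3 => (fun i : Fin 3 => ζ * Circle.exp ((t • (![1, 1, -2] : Fin 3 → ℝ)) i)) j * Circle.exp (s * (![1, -1, 0] : Fin 3 → ℝ) j)) i : Circle) : ℂ)) := by
    funext k
    fin_cases k <;> simp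
    ring_nf
  rw [mat_mul, mat_mul, mat_mkU21, hFG]

/-- The wall normaliser: `‖ζe^{−2it} − ζe^{it}‖⁴ = (2 − 2cos 3t)²`. [cite: Rogawski1990, §8.4 pp. 126–127] -/
theorem norm_wallPoint_sub_pow_four (ζ : Circle) (t : ℝ) :
    ‖((ζ * Circle.exp (-2 * t) : Circle) : ℂ) - ((ζ * Circle.exp t : Circle) : ℂ)‖ ^ 4 = (2 - 2 * Real.cos (3 * t)) ^ 2 := by
  have hsq : ‖((ζ * Circle.exp (-2 * t) : Circle) : ℂ) - ((ζ * Circle.exp t : Circle) : ℂ)‖ ^ 2 = 2 - 2 * Real.cos (3 * t) := by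
    rw [Circle.coe_mul, Circle.coe_mul, ← mul_sub, norm_mul, Circle.norm_coe, one_mul, Complex.sq_norm, Complex.normSq_apply,
      Complex.sub_re, Complex.sub_im, Circle.coe_exp, Circle.coe_exp, Complex.exp_ofReal_mul_I_re, Complex.exp_ofReal_mul_I_im,
      Complex.exp_ofReal_mul_I_re, Complex.exp_ofReal_mul_I_im]
    have h3 : Real.cos (3 * t) = Real.cos (-2 * t) * Real.cos t + Real.sin (-2 * t) * Real.sin t := by
      rw [show (3 : ℝ) * t = -((-2 * t) - t) by ring, Real.cos_neg, Real.cos_sub]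
    rw [h3]
    nlinarith [Real.sin_sq_add_cos_sq (-2 * t), Real.sin_sq_add_cos_sq t]
  calc ‖((ζ * Circle.exp (-2 * t) : Circle) : ℂ) - ((ζ * Circle.exp t : Circle) : ℂ)‖ ^ 4
      = (‖((ζ * Circle.exp (-2 * t) : Circle) : ℂ) - ((ζ * Circle.exp t : Circle) : ℂ)‖ ^ 2) ^ 2 := by ring
    _ = (2 - 2 * Real.cos (3 * t)) ^ 2 := by rw [hsq]

/-- The centre: `ζ•1 = ↑(circleDiagonal 3 ζ)`. [folklore] -/
private theorem smul_one_eq_coe_circleDiagonal (ζ : Circle) :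
    ((ζ : ℂ) • (1 : Matrix (Fin 3) (Fin 3) ℂ)) = ((circleDiagonal 3 (fun _ => ζ) : GL (Fin 3) ℂ) : Matrix (Fin 3) (Fin 3) ℂ) := by
  rw [coe_circleDiagonal, Matrix.smul_one_eq_diagonal]

/-- `ζ•1 ∈ U(2,1)` for `|ζ| = 1`. [folklore] -/
private theorem smul_one_preserves (ζ : Circle) :
    ((ζ : ℂ) • (1 : Matrix (Fin 3) (Fin 3) ℂ))ᴴ * BallModel.J * ((ζ : ℂ) • (1 : Matrix (Fin 3) (Fin 3) ℂ)) = BallModel.J := by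
  rw [Matrix.conjTranspose_smul, Matrix.conjTranspose_one, Matrix.smul_mul, Matrix.one_mul, Matrix.mul_smul, Matrix.mul_one, smul_smul]
  have h : (ζ : ℂ) * star (ζ : ℂ) = 1 := by
    rw [Complex.star_def, Complex.mul_conj, Circle.normSq_coe, Complex.ofReal_one]
  rw [h, one_smul]

/-! ## §2. The `K`-invariant ambient cut-off -/

/-- **`K`-invariant ambient cut-off.** A smooth `K`-conjugation-invariant `Θ` with compact support ON `U(2,1)` agrees on `U(2,1)` with a smooth `K`-conjugation-invariant `Θ̃`
with compact support IN `M₃(ℂ)`: `Θ̃ = (m_K⁻¹·ρ)•Θ`, `ρ` the `K`-average of a bump that is `1` on `Ad(K)·mat(tsupport Θ|_{U(2,1)})`. [cite: Helgason2000, Ch. I §1 No. 2] -/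
theorem exists_kInvariant_ambient_cutoff (Θ : Matrix (Fin 3) (Fin 3) ℂ → ℂ) (hΘ : ContDiff ℝ (⊤ : ℕ∞) Θ)
    (hc : HasCompactSupport fun u : BallModel.U21 => Θ (BallModel.mat u))
    (hK : ∀ κ : Matrix (Fin 3) (Fin 3) ℂ, κ * κᴴ = 1 → κ * BallModel.J = BallModel.J * κ → ∀ X, Θ (κ * X * κᴴ) = Θ X) :
    ∃ Θ' : Matrix (Fin 3) (Fin 3) ℂ → ℂ, ContDiff ℝ (⊤ : ℕ∞) Θ' ∧ HasCompactSupport Θ' ∧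
      (∀ κ : Matrix (Fin 3) (Fin 3) ℂ, κ * κᴴ = 1 → κ * BallModel.J = BallModel.J * κ → ∀ X, Θ' (κ * X * κᴴ) = Θ' X) ∧
      ∀ u : BallModel.U21, Θ' (BallModel.mat u) = Θ (BallModel.mat u) := by
  classical
  haveI : CompactSpace (stabilizer U21 x₀) := isCompact_iff_compactSpace.mp isCompact_stabilizer_x₀
  -- the compact set of conjugates `Ad(K)·mat(tsupport)` and a radius
  obtain ⟨S, hS⟩ : ∃ S : Set (Matrix (Fin 3) (Fin 3) ℂ), S = (fun p : stabilizer U21 x₀ × U21 =>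
      mat (p.1 : U21) * mat p.2 * mat ((p.1⁻¹ : stabilizer U21 x₀) : U21)) '' (univ ×ˢ tsupport (fun u : U21 => Θ (mat u))) := ⟨_, rfl⟩
  have hSc : IsCompact S := by
    rw [hS]
    refine (isCompact_univ.prod hc.isCompact).image ?_
    exact ((continuous_mat.comp (continuous_subtype_val.comp continuous_fst)).mul (continuous_mat.comp continuous_snd)).mul
      (continuous_mat.comp (continuous_subtype_val.comp (continuous_inv.comp continuous_fst)))
  obtain ⟨r, hr⟩ := isBounded_iff_forall_norm_le.mp hSc.isBounded
  -- the bump and its `K`-average `ρ`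
  let f : ContDiffBump (0 : Matrix (Fin 3) (Fin 3) ℂ) := ⟨|r| + 1, |r| + 2, by positivity, by linarith⟩
  obtain ⟨ρ, hρ⟩ : ∃ ρ : Matrix (Fin 3) (Fin 3) ℂ → ℝ, ρ = fun X => ∫ k : stabilizer U21 x₀,
      (f : Matrix (Fin 3) (Fin 3) ℂ → ℝ) (mat (k : U21) * X * mat ((k⁻¹ : stabilizer U21 x₀) : U21)) ∂haar := ⟨_, rfl⟩
  have hρd : ContDiff ℝ ∞ ρ := by
    rw [hρ]
    exact contDiff_kAverage (f : Matrix (Fin 3) (Fin 3) ℂ → ℝ) f.contDiff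
  have hρK : ∀ κ : Matrix (Fin 3) (Fin 3) ℂ, κ * κᴴ = 1 → κ * BallModel.J = BallModel.J * κ → ∀ X, ρ (κ * X * κᴴ) = ρ X := by
    intro κ hκ hκJ X
    rw [hρ]
    exact kAverage_conj_of_unitary_comm_J (f : Matrix (Fin 3) (Fin 3) ℂ → ℝ) hκ hκJ X
  have hρS : ∀ u : U21, u ∈ tsupport (fun u : U21 => Θ (mat u)) → ρ (mat u) = (haar : Measure (stabilizer U21 x₀)).real univ := by
    intro u hu
    have h1 : ∀ k : stabilizer U21 x₀, (f : Matrix (Fin 3) (Fin 3) ℂ → ℝ) (mat (k : U21) * mat u * mat ((k⁻¹ : stabilizer U21 x₀) : U21)) = 1 := by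
      intro k
      apply f.one_of_mem_closedBall
      rw [mem_closedBall, dist_zero_right]
      exact (hr _ (hS ▸ ⟨(k, u), ⟨mem_univ _, hu⟩, rfl⟩)).trans (by linarith [le_abs_self r])
    rw [hρ]
    simp only [h1, integral_const, smul_eq_mul, mul_one]
  have hρc : HasCompactSupport ρ := by
    refine HasCompactSupport.of_support_subset_isCompact ((isCompact_univ.prod f.hasCompactSupport).image
      (show Continuous (fun p : stabilizer U21 x₀ × Matrix (Fin 3) (Fin 3) ℂ => mat ((p.1⁻¹ : stabilizer U21 x₀) : U21) * p.2 * mat (p.1 : U21)) from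
        ((continuous_mat.comp (continuous_subtype_val.comp (continuous_inv.comp continuous_fst))).mul continuous_snd).mul
          (continuous_mat.comp (continuous_subtype_val.comp continuous_fst)))) ?_
    intro X hX
    rw [Function.mem_support, hρ] at hX
    obtain ⟨k, hk⟩ : ∃ k : stabilizer U21 x₀, (f : Matrix (Fin 3) (Fin 3) ℂ → ℝ) (mat (k : U21) * X * mat ((k⁻¹ : stabilizer U21 x₀) : U21)) ≠ 0 := by
      by_contra h
      push Not at h
      exact hX (by simp_rw [h, integral_zero])
    refine ⟨(k, mat (k : U21) * X * mat ((k⁻¹ : stabilizer U21 x₀) : U21)), ⟨mem_univ _, subset_tsupport _ hk⟩, ?_⟩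
    have hkk : mat ((k⁻¹ : stabilizer U21 x₀) : U21) * mat (k : U21) = 1 := by
      simpa only [inv_inv] using mat_coe_mul_mat_coe_inv k⁻¹
    simp only [Matrix.mul_assoc]
    rw [hkk, Matrix.mul_one, ← Matrix.mul_assoc, hkk, Matrix.one_mul]
  -- the mass of `K`
  obtain ⟨m, hm⟩ : ∃ m : ℝ, m = (haar : Measure (stabilizer U21 x₀)).real univ := ⟨_, rfl⟩
  have hm0 : 0 < m := by rw [hm]; exact measureReal_univ_pos
  -- the cut-off test function
  refine ⟨fun X => (m⁻¹ * ρ X) • Θ X, (contDiff_const.mul hρd).smul hΘ, ?_, ?_, ?_⟩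
  · have h1 : HasCompactSupport fun X => m⁻¹ * ρ X := hρc.mul_left
    exact h1.smul_right
  · intro κ hκ hκJ X
    simp only [hρK κ hκ hκJ X, hK κ hκ hκJ X]
  · intro u
    by_cases hu : u ∈ tsupport (fun u : U21 => Θ (mat u))
    · simp only [hρS u hu, ← hm, inv_mul_cancel₀ hm0.ne', one_smul]
    · have h0 : Θ (mat u) = 0 := image_eq_zero_of_notMem_tsupport (f := fun u : U21 => Θ (mat u)) hu
      simp only [h0, smul_zero]

/-! ## §3. The packaging: W6's `hcore` gives (o4)'s `hBall` -/

/-- **«hBall ⟸ hCore»**: W6's deliverable `hcore` — for every Haar `μ` on `U(2,1)` one `c(μ) > 0` such that every smooth, AMBIENTLY compactly supported,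
`K`-conjugation-invariant `Θ` and every `ζ` admit `δ ∈ (0, 2]` and `C²` germs `ψ, χ` on `[0, δ]` with `ψ t =` ★ `exists_wallGerm_psi`'s LHS, `χ t =` ★ `exists_wallGerm_chi`'s LHS
(`t ∈ (0, δ)`) and `−(2i∕3)ψ″(0⁺) − (i∕2)ψ(0) + (i∕12)χ″(0⁺) = −c·i·Θ(ζ•1)` — implies ★ (o4)'s `hBall`. [cite: Rogawski1990, §8.4 pp. 126–127] [cite: Helgason2000, Ch. I §1 No. 2] -/
theorem ballWallValue_of_core
    (hcore : ∀ (μ : Measure BallModel.U21) [μ.IsHaarMeasure],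
      ∃ c : ℝ, 0 < c ∧ ∀ (Θ : Matrix (Fin 3) (Fin 3) ℂ → ℂ), ContDiff ℝ (⊤ : ℕ∞) Θ → HasCompactSupport Θ →
        (∀ κ : Matrix (Fin 3) (Fin 3) ℂ, κ * κᴴ = 1 → κ * BallModel.J = BallModel.J * κ → ∀ X, Θ (κ * X * κᴴ) = Θ X) →
        ∀ ζ : Circle, ∃ (δ : ℝ) (ψ χ : ℝ → ℂ), 0 < δ ∧ δ ≤ 2 ∧ ContDiffOn ℝ 2 ψ (Icc 0 δ) ∧ ContDiffOn ℝ 2 χ (Icc 0 δ) ∧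
          (∀ t ∈ Ioo 0 δ, (2 - 2 * Real.cos (3 * t)) • (∫ g, Θ (BallModel.mat (g * BallModel.mkU21 (Matrix.diagonal ![((ζ * Circle.exp t : Circle) : ℂ), ((ζ * Circle.exp t : Circle) : ℂ), ((ζ * Circle.exp (-2 * t) : Circle) : ℂ)]) (BallModel.diagonal_uuv_preserves (ζ * Circle.exp t) (ζ * Circle.exp (-2 * t))) * g⁻¹)) ∂μ) = ψ t) ∧
          (∀ t ∈ Ioo 0 δ, ‖((ζ * Circle.exp (-2 * t) : Circle) : ℂ) - ((ζ * Circle.exp t : Circle) : ℂ)‖ ^ 4 •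
            iteratedDeriv 2 (fun y : ℝ => ∫ u : BallModel.U21, Θ (BallModel.mat u * Matrix.diagonal (fun k : Fin 3 => (((![ζ * Circle.exp t, ζ * Circle.exp t, ζ * Circle.exp (-2 * t)] : Fin 3 → Circle) k * Circle.exp (y * ((if k = (0 : Fin 3) then (1 : ℝ) else 0) - (if k = (1 : Fin 3) then (1 : ℝ) else 0))) : Circle) : ℂ)) * BallModel.mat u⁻¹) ∂μ) 0 = χ t) ∧
          -(2 / 3) * Complex.I * iteratedDerivWithin 2 ψ (Icc 0 δ) 0 - (1 / 2) * Complex.I * ψ 0 + (1 / 12) * Complex.I * iteratedDerivWithin 2 χ (Icc 0 δ) 0 =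
            -((c : ℂ) * Complex.I) * Θ ((ζ : ℂ) • (1 : Matrix (Fin 3) (Fin 3) ℂ))) :
    ∀ (μ : Measure BallModel.U21) [μ.IsHaarMeasure],
      ∃ c : ℝ, 0 < c ∧ ∀ (Θ' : Matrix (Fin 3) (Fin 3) ℂ → ℂ), ContDiff ℝ (⊤ : ℕ∞) Θ' →
        HasCompactSupport (fun u : BallModel.U21 => Θ' (BallModel.mat u)) →
        (∀ κ : Matrix (Fin 3) (Fin 3) ℂ, κ * κᴴ = 1 → κ * BallModel.J = BallModel.J * κ → ∀ X, Θ' (κ * X * κᴴ) = Θ' X) →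
        ∀ ζ : Circle, ∃ (δ : ℝ) (ψ χ : ℝ → ℂ), 0 < δ ∧ δ ≤ 2 ∧ ContDiffOn ℝ 2 ψ (Icc 0 δ) ∧ ContDiffOn ℝ 2 χ (Icc 0 δ) ∧
          (∀ t ∈ Ioo 0 δ, ψ t = ((2 - 2 * Real.cos (3 * t) : ℝ) : ℂ) *
            ∫ u, Θ' (BallModel.mat (u * BallModel.mkU21 (Matrix.diagonal fun i => (((fun j : Fin 3 => ζ * Circle.exp ((t • (![1, 1, -2] : Fin 3 → ℝ)) j)) i : Circle) : ℂ)) (BallModel.diagonal_circle_preserves (fun j : Fin 3 => ζ * Circle.exp ((t • (![1, 1, -2] : Fin 3 → ℝ)) j))) * u⁻¹)) ∂μ) ∧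
          (∀ t ∈ Ioo 0 δ, χ t = ((2 - 2 * Real.cos (3 * t) : ℝ) : ℂ) ^ 2 * iteratedDeriv 2 (fun s : ℝ =>
            ∫ u, Θ' (BallModel.mat (u * BallModel.mkU21 (Matrix.diagonal fun i => (((fun j : Fin 3 => (fun i : Fin 3 => ζ * Circle.exp ((t • (![1, 1, -2] : Fin 3 → ℝ)) i)) j * Circle.exp (s * (![1, -1, 0] : Fin 3 → ℝ) j)) i : Circle) : ℂ)) (BallModel.diagonal_circle_preserves (fun j : Fin 3 => (fun i : Fin 3 => ζ * Circle.exp ((t • (![1, 1, -2] : Fin 3 → ℝ)) i)) j * Circle.exp (s * (![1, -1, 0] : Fin 3 → ℝ) j))) * u⁻¹)) ∂μ) 0) ∧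
          -(2 / 3) * Complex.I * iteratedDerivWithin 2 ψ (Icc 0 δ) 0 - (1 / 2) * Complex.I * ψ 0 + (1 / 12) * Complex.I * iteratedDerivWithin 2 χ (Icc 0 δ) 0 =
            -((c : ℂ) * Complex.I) * Θ' ((circleDiagonal 3 (fun _ => ζ) : GL (Fin 3) ℂ) : Matrix (Fin 3) (Fin 3) ℂ) := by
  intro μ _
  obtain ⟨c, hc, H⟩ := hcore μ
  refine ⟨c, hc, fun Θ' hΘ' hΘ'c hK ζ => ?_⟩
  obtain ⟨Θ₁, h₁d, h₁c, h₁K, h₁eq⟩ := exists_kInvariant_ambient_cutoff Θ' hΘ' hΘ'c hK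
  obtain ⟨δ, ψ, χ, hδ, hδ2, hψ, hχ, hψd, hχd, hval⟩ := H Θ₁ h₁d h₁c h₁K ζ
  refine ⟨δ, ψ, χ, hδ, hδ2, hψ, hχ, fun t ht => ?_, fun t ht => ?_, ?_⟩
  · rw [← hψd t ht, Complex.real_smul]
    simp only [h₁eq, mkU21_wallPoint_eq]
  · rw [← hχd t ht, Complex.real_smul, norm_wallPoint_sub_pow_four, Complex.ofReal_pow]
    simp only [mat_mul_normalRayDiagonal_mul_mat_inv_eq, h₁eq]
  · rw [hval, show ((ζ : ℂ) • (1 : Matrix (Fin 3) (Fin 3) ℂ)) = BallModel.mat (BallModel.mkU21 ((ζ : ℂ) • (1 : Matrix (Fin 3) (Fin 3) ℂ)) (smul_one_preserves ζ)) from rfl,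
      h₁eq, mat_mkU21, smul_one_eq_coe_circleDiagonal]

/-! ## §4. The composite for the closer -/

variable (L : Type) [Field L] (α : Fin 3 → L) (w : {w : InfinitePlace L // IsComplex w})

/-- **The D-chamber wall value on `G_w` from W6's `hcore`** = ★ `cornerValue_min_of_ball ∘ ballWallValue_of_core` (e-pattern frames `re σα₀, re σα₁ > 0 > re σα₂`; the conclusion is
★ FILE A′∕B's `hDmin` binder verbatim). [cite: Rogawski1990, §8.4 pp. 126–127] -/
theorem cornerValue_min_of_core (h0 : 0 < (w.1.embedding (α 0)).re) (h1 : 0 < (w.1.embedding (α 1)).re) (h2 : (w.1.embedding (α 2)).re < 0)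
    (hcore : ∀ (μ : Measure BallModel.U21) [μ.IsHaarMeasure],
      ∃ c : ℝ, 0 < c ∧ ∀ (Θ : Matrix (Fin 3) (Fin 3) ℂ → ℂ), ContDiff ℝ (⊤ : ℕ∞) Θ → HasCompactSupport Θ →
        (∀ κ : Matrix (Fin 3) (Fin 3) ℂ, κ * κᴴ = 1 → κ * BallModel.J = BallModel.J * κ → ∀ X, Θ (κ * X * κᴴ) = Θ X) →
        ∀ ζ : Circle, ∃ (δ : ℝ) (ψ χ : ℝ → ℂ), 0 < δ ∧ δ ≤ 2 ∧ ContDiffOn ℝ 2 ψ (Icc 0 δ) ∧ ContDiffOn ℝ 2 χ (Icc 0 δ) ∧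
          (∀ t ∈ Ioo 0 δ, (2 - 2 * Real.cos (3 * t)) • (∫ g, Θ (BallModel.mat (g * BallModel.mkU21 (Matrix.diagonal ![((ζ * Circle.exp t : Circle) : ℂ), ((ζ * Circle.exp t : Circle) : ℂ), ((ζ * Circle.exp (-2 * t) : Circle) : ℂ)]) (BallModel.diagonal_uuv_preserves (ζ * Circle.exp t) (ζ * Circle.exp (-2 * t))) * g⁻¹)) ∂μ) = ψ t) ∧
          (∀ t ∈ Ioo 0 δ, ‖((ζ * Circle.exp (-2 * t) : Circle) : ℂ) - ((ζ * Circle.exp t : Circle) : ℂ)‖ ^ 4 •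
            iteratedDeriv 2 (fun y : ℝ => ∫ u : BallModel.U21, Θ (BallModel.mat u * Matrix.diagonal (fun k : Fin 3 => (((![ζ * Circle.exp t, ζ * Circle.exp t, ζ * Circle.exp (-2 * t)] : Fin 3 → Circle) k * Circle.exp (y * ((if k = (0 : Fin 3) then (1 : ℝ) else 0) - (if k = (1 : Fin 3) then (1 : ℝ) else 0))) : Circle) : ℂ)) * BallModel.mat u⁻¹) ∂μ) 0 = χ t) ∧
          -(2 / 3) * Complex.I * iteratedDerivWithin 2 ψ (Icc 0 δ) 0 - (1 / 2) * Complex.I * ψ 0 + (1 / 12) * Complex.I * iteratedDerivWithin 2 χ (Icc 0 δ) 0 =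
            -((c : ℂ) * Complex.I) * Θ ((ζ : ℂ) • (1 : Matrix (Fin 3) (Fin 3) ℂ))) :
    ∀ [MeasurableSpace (archLocal L 3 (Matrix.diagonal α) w)] [BorelSpace (archLocal L 3 (Matrix.diagonal α) w)],
      (∀ i, α i ≠ 0) → (∀ i, (w.1.embedding (α i)).im = 0) →
      (∃ i j : Fin 3, (w.1.embedding (α i)).re * (w.1.embedding (α j)).re < 0) →
      ∀ (ν : Measure (archLocal L 3 (Matrix.diagonal α) w)) [ν.IsHaarMeasure] [ν.IsMulRightInvariant],
      ∃ c : ℝ, 0 < c ∧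
        ∀ (Θ : Matrix (Fin 3) (Fin 3) ℂ → ℂ), ContDiff ℝ (⊤ : ℕ∞) Θ →
          HasCompactSupport (fun k : archLocal L 3 (Matrix.diagonal α) w => Θ ((k : GL (Fin 3) ℂ) : Matrix (Fin 3) (Fin 3) ℂ)) →
          ∀ (ζ : Circle) (σ : Equiv.Perm (Fin 3)), (σ 0 = 2) →
            ∀ (U : Set (Fin 3 → ℝ)) (H : (Fin 3 → ℝ) → ℂ), IsOpen U → (0 : Fin 3 → ℝ) ∈ U → ContDiffOn ℝ 3 H U →
            (∀ θ ∈ U, θ (σ 0) < θ (σ 1) ∧ θ (σ 1) < θ (σ 2) →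
              H θ = ((((ζ * Circle.exp (θ 0) : Circle) : ℂ)) * (((ζ * Circle.exp (θ 2) : Circle) : ℂ))⁻¹) * ((1 - (((ζ * Circle.exp (θ 1) : Circle) : ℂ)) * (((ζ * Circle.exp (θ 0) : Circle) : ℂ))⁻¹) * (1 - (((ζ * Circle.exp (θ 2) : Circle) : ℂ)) * (((ζ * Circle.exp (θ 1) : Circle) : ℂ))⁻¹) * (1 - (((ζ * Circle.exp (θ 2) : Circle) : ℂ)) * (((ζ * Circle.exp (θ 0) : Circle) : ℂ))⁻¹)) * (∫ g, Θ (((g * ⟨circleDiagonal 3 (fun k => ζ * Circle.exp (θ k)), circleDiagonal_mem_archLocal_diagonal L 3 α w _⟩ * g⁻¹ : archLocal L 3 (Matrix.diagonal α) w) : GL (Fin 3) ℂ) : Matrix (Fin 3) (Fin 3) ℂ) ∂ν)) →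
            (1 / 48 : ℂ) * ∑ ε : Fin 3 → Bool, ((((if ε 0 then (1 : ℝ) else -1) * (if ε 1 then (1 : ℝ) else -1) * (if ε 2 then (1 : ℝ) else -1) : ℝ)) : ℂ) *
          iteratedDeriv 3 (fun s : ℝ => H (s • ![(if ε 0 then (1 : ℝ) else -1) + (if ε 1 then (1 : ℝ) else -1), -(if ε 0 then (1 : ℝ) else -1) + (if ε 2 then (1 : ℝ) else -1), -(if ε 1 then (1 : ℝ) else -1) - (if ε 2 then (1 : ℝ) else -1)])) 0 =
                -((c : ℂ) * Complex.I) * Θ ((circleDiagonal 3 (fun _ => ζ) : GL (Fin 3) ℂ) : Matrix (Fin 3) (Fin 3) ℂ) :=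
  cornerValue_min_of_ball L α w h0 h1 h2 (ballWallValue_of_core hcore)

end

end Literature.NumberTheory.Rogawski1990
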